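import Mathlib

/-!
# Chebyshev second-kind moments `τ_k` and the `U_k`-defects of a rule (Davis–Rabinowitz, Sect. 4.7.2)

Davis & Rabinowitz, *Methods of Numerical Integration* (2nd ed., 1984), Sect. 4.7.2, write the
`L²(ℰ_ρ)` error norm of a rule `E(f) = ∫_{-1}^{1} f - Σ wᵢ f(xᵢ)` as a weighted sum of squares of the
*defects* `τ_k - Σᵢ wᵢ U_k(xᵢ)` (4.7.2.4), where

  `τ_k = ∫_{-1}^{1} U_k(x) dx = (1 + (-1)^k)/(k + 1)`                                   (4.7.2.5)

are the moments of the Chebyshev polynomials of the second kind. This file records (4.7.2.5) with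
proof (substitution `x = cos θ`, `U_k(cos θ) sin θ = sin((k+1)θ)`), the defect functional of a rule
against `U_k`, and its vanishing below the rule's degree of exactness.

(The companion first-kind moments `∫ T_k = (1 + (-1)^k)/(1 - k²)` of (4.7.2.9) are recorded with the
Fejér rules, Sect. 2.5.5.)
-/

namespace Literature.Analysis.Quadrature

open Polynomial Polynomial.Chebyshev Real intervalIntegral Finset

/-- The Chebyshev second-kind moments `τ_k = (1 + (-1)^k)/(k + 1)`.
[cite: DavisRabinowitz1984, Sect. 4.7.2 (4.7.2.5)] -/
noncomputable def chebyshevUMoment (k : ℕ) : ℝ := (1 + (-1 : ℝ) ^ k) / (k + 1)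

/-- `∫_0^π sin((k+1)θ) dθ = (1 + (-1)^k)/(k+1)`. [folklore] -/
private theorem integral_sin_succ_mul (k : ℕ) :
    ∫ θ in (0:ℝ)..π, sin (((k:ℝ) + 1) * θ) = (1 + (-1 : ℝ) ^ k) / (k + 1) := by
  have hc : ((k:ℝ) + 1) ≠ 0 := by positivity
  rw [intervalIntegral.integral_comp_mul_left (fun θ => sin θ) hc, integral_sin]
  simp only [mul_zero, cos_zero, smul_eq_mul]
  have : cos (((k:ℝ) + 1) * π) = -((-1 : ℝ) ^ k) := by
    rw [add_mul, one_mul, cos_add_pi, cos_nat_mul_pi]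
  rw [this]; field_simp; ring

/-- **(4.7.2.5)**: `∫_{-1}^{1} U_k(x) dx = τ_k = (1 + (-1)^k)/(k + 1)` (substitute `x = cos θ` and use
`U_k(cos θ) sin θ = sin((k+1)θ)`). [cite: DavisRabinowitz1984, Sect. 4.7.2 (4.7.2.5)] -/
theorem integral_chebyshevU (k : ℕ) :
    ∫ x in (-1:ℝ)..1, (U ℝ k).eval x = chebyshevUMoment k := by
  have hsub := intervalIntegral.integral_comp_mul_deriv (a := 0) (b := π) (f := cos)
    (f' := fun θ => -sin θ) (g := fun x => (U ℝ k).eval x) (fun θ _ => hasDerivAt_cos θ)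
    (continuous_sin.neg.continuousOn) (U ℝ (k:ℤ)).continuous
  simp only [Function.comp_def, cos_zero, cos_pi] at hsub
  rw [intervalIntegral.integral_symm (-1:ℝ) 1] at hsub
  have h2 : ∫ θ in (0:ℝ)..π, (U ℝ k).eval (cos θ) * -sin θ
      = -∫ θ in (0:ℝ)..π, sin (((k:ℝ) + 1) * θ) := by
    rw [← intervalIntegral.integral_neg]
    refine integral_congr fun θ _ => ?_
    have := U_real_cos θ k
    push_cast at this
    simp only [mul_neg, this]
  rw [h2] at hsub
  have : ∫ x in (-1:ℝ)..1, (U ℝ k).eval x = ∫ θ in (0:ℝ)..π, sin (((k:ℝ) + 1) * θ) := by linarith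
  rw [this, integral_sin_succ_mul]; rfl

/-- Even moments: `τ_{2m} = 2/(2m+1)`. [cite: DavisRabinowitz1984, Sect. 4.7.2 (4.7.2.5)] -/
theorem chebyshevUMoment_even (m : ℕ) : chebyshevUMoment (2 * m) = 2 / (2 * m + 1) := by
  simp [chebyshevUMoment, pow_mul]; ring

/-- Odd moments vanish: `τ_{2m+1} = 0`. [cite: DavisRabinowitz1984, Sect. 4.7.2 (4.7.2.5)] -/
theorem chebyshevUMoment_odd (m : ℕ) : chebyshevUMoment (2 * m + 1) = 0 := by
  simp [chebyshevUMoment, pow_succ, pow_mul]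

/-- The `U_k`-defect of an `n`-point rule `(w, x)` on `[-1, 1]`: `τ_k - Σᵢ wᵢ U_k(xᵢ)`, the bracket
of (4.7.2.4). [cite: DavisRabinowitz1984, Sect. 4.7.2 (4.7.2.4)] -/
noncomputable def ruleDefectU {n : ℕ} (w x : Fin n → ℝ) (k : ℕ) : ℝ :=
  chebyshevUMoment k - ∑ i, w i * (U ℝ k).eval (x i)

/-- The defect is the rule's error on `U_k`: `τ_k - Σ wᵢ U_k(xᵢ) = E(U_k)`.
[cite: DavisRabinowitz1984, Sect. 4.7.2 (4.7.2.4)] -/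
theorem ruleDefectU_eq_error {n : ℕ} (w x : Fin n → ℝ) (k : ℕ) :
    ruleDefectU w x k = (∫ t in (-1:ℝ)..1, (U ℝ k).eval t) - ∑ i, w i * (U ℝ k).eval (x i) := by
  rw [ruleDefectU, integral_chebyshevU]

/-- A rule exact on all polynomials of degree `≤ d` has vanishing `U_k`-defects for `k ≤ d`, so the
series (4.7.2.4) starts at `k = d + 1`. [cite: DavisRabinowitz1984, Sect. 4.7.2 (4.7.2.4)] -/
theorem ruleDefectU_eq_zero_of_exact {n : ℕ} (w x : Fin n → ℝ) {d : ℕ}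
    (hex : ∀ p : ℝ[X], p.natDegree ≤ d → ∑ i, w i * p.eval (x i) = ∫ t in (-1:ℝ)..1, p.eval t)
    {k : ℕ} (hk : k ≤ d) : ruleDefectU w x k = 0 := by
  have hdeg : (U ℝ k).natDegree ≤ d := by rw [natDegree_U_natCast]; exact hk
  rw [ruleDefectU_eq_error, ← hex (U ℝ k) hdeg, sub_self]

/-- `|U_n(x)| ≤ n + 1` for `|x| ≤ 1` (the Inequality of Sect. 1.13, entry III; by induction from
`U_{n+1} = x U_n + T_{n+1}` and `|T_k(x)| ≤ 1`). The tree already has this lemma as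
`Literature.Probability.FitznerVanDerHofstad2017.abs_eval_U_le`; it is re-proved privately here to keep
the imports of this file to Mathlib. [folklore] -/
private theorem abs_eval_U_real_le (n : ℕ) {x : ℝ} (hx : |x| ≤ 1) : |(U ℝ n).eval x| ≤ n + 1 := by
  induction n with
  | zero => simp
  | succ n ih =>
    have h := congrArg (fun p : ℝ[X] => p.eval x) (Polynomial.Chebyshev.U_eq_X_mul_U_add_T ℝ (n:ℤ))
    simp only [eval_add, eval_mul, eval_X] at h
    have hT := abs_eval_T_real_le_one ((n:ℤ) + 1) hx
    have hcast : (U ℝ ((n + 1 : ℕ) : ℤ)) = U ℝ ((n:ℤ) + 1) := by push_cast; rfl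
    rw [hcast, h]
    calc |x * (U ℝ n).eval x + (T ℝ (n + 1)).eval x|
        ≤ |x * (U ℝ n).eval x| + |(T ℝ (n + 1)).eval x| := abs_add_le _ _
      _ = |x| * |(U ℝ n).eval x| + |(T ℝ (n + 1)).eval x| := by rw [abs_mul]
      _ ≤ 1 * (n + 1) + 1 := by gcongr
      _ = (n + 1 : ℕ) + 1 := by push_cast; ring

/-- The moments are nonnegative: `τ_k ≥ 0`. [cite: DavisRabinowitz1984, Sect. 4.7.2 (4.7.2.5)] -/
theorem chebyshevUMoment_nonneg (k : ℕ) : 0 ≤ chebyshevUMoment k := by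
  unfold chebyshevUMoment
  rcases neg_one_pow_eq_or ℝ k with h | h <;> rw [h] <;> positivity

/-- A priori bound on the `U_k`-defect of a rule with nodes in `[-1, 1]`:
`|τ_k - Σ wᵢ U_k(xᵢ)| ≤ τ_k + (k + 1) Σ |wᵢ|` (from `|U_k| ≤ k + 1`, Sect. 1.13 (III)), the estimate that makes the
series (4.7.2.4) converge for `ρ > 1`. [cite: DavisRabinowitz1984, Sect. 4.7.2 (4.7.2.4)] -/
theorem abs_ruleDefectU_le {n : ℕ} (w x : Fin n → ℝ) (hx : ∀ i, |x i| ≤ 1) (k : ℕ) :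
    |ruleDefectU w x k| ≤ chebyshevUMoment k + (k + 1) * ∑ i, |w i| := by
  unfold ruleDefectU
  calc |chebyshevUMoment k - ∑ i, w i * (U ℝ k).eval (x i)|
      ≤ |chebyshevUMoment k| + |∑ i, w i * (U ℝ k).eval (x i)| := abs_sub _ _
    _ ≤ chebyshevUMoment k + ∑ i, |w i| * (k + 1) := by
        gcongr
        · exact (abs_of_nonneg (chebyshevUMoment_nonneg k)).le
        · exact (abs_sum_le_sum_abs _ _).trans (sum_le_sum fun i _ => by
            rw [abs_mul]; exact mul_le_mul_of_nonneg_left (abs_eval_U_real_le k (hx i)) (abs_nonneg _))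
    _ = chebyshevUMoment k + (k + 1) * ∑ i, |w i| := by rw [← sum_mul]; ring

end Literature.Analysis.Quadrature
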